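import Summits.QuantumFields.BalabanUV.Beta.GAN24.TaylorRowLamInnerAt
import Summits.QuantumFields.BalabanUV.Beta.GAN24.TaylorRowLamTable

/-!
# `BalabanUV.Beta.GAN24.TaylorRowLamTableAt` — binder row G-an2-4 / (CONV-C), S-slot, road «S3-Taylor», Λ SHAPE rows AT THE IN-BLOCK ROOT `r`,
# part 2 of 3: the hypotheses of `TaylorSandwich.sandwich_bound` for the rewritten ROOTED sandwich (twin of `TaylorRowLamTable`)

NOT IN PRINT; OUR PROOF ATTEMPT.  HONEST FRAMING (cell contract, verbatim): «discharging `BetaPertH` makes Bałaban's UV stability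
UNCONDITIONAL — a real constructive-QFT result; it is NOT the continuum limit and NOT the Clay problem.»  HONEST DEPENDENCY (verbatim):
«continuum YM on T⁴ ⇐ BetaPertH ∧ nine spine estimates (0/9 proved); BetaPertH ⇐ (D1) ∧ (D4) ∧ CAP+tail; G-an2-4 gates asym, D1 and
NE2/3/4.»  [folklore] bookkeeping: the proofs of the base module VERBATIM with an1's ROOTED constraint Hessian `hessFFAt (toSite r) Lc`
(`r ∈ box (d+1) Lc`, `AveragingHessianKernelsRooted`) in place of `hessFF Lc = hessFFAt 0 Lc` and the rooted Lagrange increment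
`SpineRooted.lagrIncAt d (toSite r) Lc` in place of `BalabanCompositeJets.lagrInc d Lc`; every ROOT-FREE lemma of the base module is used BY
NAME (not re-declared); same theorem names in this namespace; no cited fact, no `def`, no `Prop` mirror, 0 sorry; nothing of the base module is
edited.  Discharges NOTHING of (hS, hSall), the K-slot or BetaPertH by itself; NEVER «G-an2-4 closed»; NOT (CONV-C) as typed, NOT D1, NOT
BetaPertH, NOT continuum, NOT Clay.  OWNER's request: gan24-p1 g21 (W5) «ROOTED-S3-Λ» package (ρ-c) (HOME/CLAIMS.log 2026-08-21 l.34168 ∕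
l.34364 (W9); INBOX [GAN24P1-G21-INBOX1] l.14224), typed by `b2b-balaban-gan24-formalise-leaf-06` gen 40 (MINE l.34402); inputs (ρ-a)
`TaylorMassLamAt` and (ρ-b) `E3UnitSplitLevelsAt` (leaf-01 g60) BY NAME.

## Contents (root `r ∈ box (d+1) Lc`)
§3-ρ `abs_onLat_avgLift_le`, `mem_boxW_of_ne_zero`, `mem_imageY_of_ne_zero`, `table_mass_le` for the table `onLat N′ (avgLift M ∘ hessFFAt (toSite r) Lc μ)` (SAME
boxes and masses as the base, by (ρ-a)'s `abs_avgLift_hessFFAt_le` ∕ `avgLift_hessFFAt_ne_zero`); §4a-ρ **`abs_sandwich_le`** (the owner's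
`TaylorSandwich.sandwich_bound`, verbatim bookkeeping).  The root-free lemmas of the base part 2 (`l1_sub_zsmul_quo_le`, `l1_zsmul_sub_le_of_mem_box`,
`mem_boxY_of_l1_le`, `l1_le_of_mem_imageY`, `abs_vertexLeg_le`) are used BY NAME.
-/

noncomputable section

open Finset
open scoped BigOperators
open Literature.MathematicalPhysics.QuantumFieldTheory
open Literature.MathematicalPhysics.QuantumFieldTheory.Balaban1983to89
open Literature.MathematicalPhysics.QuantumFieldTheory.Balaban1983to89.Beta
open Literature.Probability.LatticeModels (Torus.proj Torus.proj_apply)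
open AffineAveraging (Site Form1 unitVec unitVec_apply box toSite)
open AffineReproduction (contourSumAdj)
open LatticeForm (quo)
open B12Sec2to5 (l1 l1_nonneg)
open ExpKernelCalculus (MKer Zl BiLoc l1_sub_triangle l1_sub_symm l1_natSmul)
open OneStepResolventKernel (Fib KInv LocStencil proj_zsmul quo_zsmul eq_zsmul_quo_of_proj KInv_inr_inr_coarse)
open KernelSpecInstance (wH wΦ)
open KKTFluctuationKernel (GamΦ)
open InterLevelTransport (SLam avgLift cwsum cwsum_apply onLat onLat_zsmul onLat_off)
open BalabanStepJets (lamCoeffOf)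
open BalabanCompositeJets (lagrInc)
open AveragingHessianKernels (hessFF ell)
open Summit.QuantumFields.BalabanUV.Beta.GAN24.TaylorLamVertexPairing (vertexPair_eq summable_wH_mul_lamCoeffOf quo_quo
  abs_contourSumAdj_le_exp)
open Summit.QuantumFields.BalabanUV.Beta.GAN24.TaylorSandwich (sandwich_bound)
open AveragingHessianKernelsRooted (hessFFAt hessFFAt_zero)
open Summit.QuantumFields.BalabanUV.Beta.SpineRooted (lagrIncAt lagrIncAt_zero)
open Summit.QuantumFields.BalabanUV.Beta.GAN24.TaylorMassLamAt (abs_avgLift_hessFFAt_le avgLift_hessFFAt_ne_zero)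
open Summit.QuantumFields.BalabanUV.Beta.GAN24.TaylorRowLam (mem_box_of_l1_le l1_le_of_mem_box card_box l1_sub_zsmul_quo_le
  l1_zsmul_sub_le_of_mem_box mem_boxY_of_l1_le l1_le_of_mem_imageY abs_vertexLeg_le)
open Summit.QuantumFields.BalabanUV.Beta.GAN24.TaylorBlockSum (abs_ediv_sub_ediv_le nonneg_of_dominated)

namespace Summit.QuantumFields.BalabanUV.Beta.GAN24.TaylorRowLamAt

variable {d : ℕ}

section Table

variable {Lc : ℕ} [NeZero Lc] {r : Fin (d + 1) → ℕ}

/-! ## §3 The hypotheses of `TaylorSandwich.sandwich_bound` for the rewritten sandwich -/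

/-- [folklore] The on-lattice table is bounded like the lifted constraint Hessian: `≤ 2ℓ²/M^{2(d+1)}` ((ρ-a)'s `abs_avgLift_hessFFAt_le`, leaf-11's bound at the root; `0` off the sublattice). -/
theorem abs_onLat_avgLift_le (hr : r ∈ box (d + 1) Lc) (N' M : ℕ) [NeZero M] (μ : Fin (d + 1)) (v w y : Site (d + 1)) (a b : Fib d) :
    |onLat N' (fun Y => avgLift M (hessFFAt (toSite r) Lc μ Y)) v w y a b| ≤ 2 * (ell (d + 1) Lc : ℝ) ^ 2 / (M : ℝ) ^ (2 * (d + 1)) := by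
  by_cases hv : Torus.proj N' v = 0
  · simp only [onLat, hv, if_true]
    exact abs_avgLift_hessFFAt_le M (Nat.one_le_iff_ne_zero.2 (NeZero.ne Lc)) hr μ _ w y a b
  · rw [onLat_off _ hv]
    simp only [Pi.zero_apply, abs_zero]
    positivity

/-- [folklore] SUPPORT IN THE FIELD LEG `w`: a nonzero on-lattice table entry has `w` in the sup-norm box of radius `2·(2(d+1)(Lc+1)M)` around `y`
(both fine legs within leaf-11's radius of the same coarse image). -/
theorem mem_boxW_of_ne_zero (hr : r ∈ box (d + 1) Lc) (N' M : ℕ) [NeZero M] {μ : Fin (d + 1)} {v w y : Site (d + 1)} {a b : Fib d}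
    (h : onLat N' (fun Y => avgLift M (hessFFAt (toSite r) Lc μ Y)) v w y a b ≠ 0) :
    w ∈ Fintype.piFinset fun j => Finset.Icc (y j - (2 * (2 * (d + 1) * (Lc + 1) * M) : ℕ)) (y j + (2 * (2 * (d + 1) * (Lc + 1) * M) : ℕ)) := by
  by_cases hv : Torus.proj N' v = 0
  · simp only [onLat, hv, if_true] at h
    obtain ⟨hw, hy⟩ := avgLift_hessFFAt_ne_zero M (Nat.one_le_iff_ne_zero.2 (NeZero.ne Lc)) hr h
    refine mem_box_of_l1_le y w _ ?_
    have tri := l1_sub_triangle w (((M * Lc : ℕ) : ℤ) • quo N' v) y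
    rw [l1_sub_symm (((M * Lc : ℕ) : ℤ) • quo N' v) y] at tri
    push_cast
    linarith
  · exact absurd (by rw [onLat_off _ hv]; rfl) h

/-- [folklore] SUPPORT IN THE VERTEX VARIABLE `v`: a nonzero on-lattice table entry has `v = N′•Y` with `Y` in the sup-norm box of radius
`4(d+1)+1` around `quo N′ y`. -/
theorem mem_imageY_of_ne_zero (hr : r ∈ box (d + 1) Lc) (N' M : ℕ) [NeZero M] (hN' : N' = M * Lc) {μ : Fin (d + 1)} {v w y : Site (d + 1)} {a b : Fib d}
    (h : onLat N' (fun Y => avgLift M (hessFFAt (toSite r) Lc μ Y)) v w y a b ≠ 0) :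
    v ∈ (Fintype.piFinset fun j => Finset.Icc (quo N' y j - (4 * (d + 1) + 1 : ℕ)) (quo N' y j + (4 * (d + 1) + 1 : ℕ))).image
      (fun Y : Site (d + 1) => (N' : ℤ) • Y) := by
  haveI : NeZero N' := ⟨by rw [hN']; exact Nat.mul_ne_zero (NeZero.ne M) (NeZero.ne Lc)⟩
  by_cases hv : Torus.proj N' v = 0
  · simp only [onLat, hv, if_true] at h
    obtain ⟨-, hy⟩ := avgLift_hessFFAt_ne_zero M (Nat.one_le_iff_ne_zero.2 (NeZero.ne Lc)) hr h
    rw [Finset.mem_image]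
    refine ⟨quo N' v, ?_, (eq_zsmul_quo_of_proj (d := d) hv).symm⟩
    subst hN'
    exact mem_boxY_of_l1_le (Lc := Lc) M (x := y) (Y := quo (M * Lc) v) hy
  · exact absurd (by rw [onLat_off _ hv]; rfl) h

/-- [folklore] COLUMN MASS of the on-lattice table over the two support boxes: `≤ #S_w·(d+1)·(d+1)·#box_Y·2ℓ²/M^{2(d+1)}`. -/
theorem table_mass_le (hr : r ∈ box (d + 1) Lc) (N' M : ℕ) [NeZero N'] [NeZero M] (y : Site (d + 1)) (l' : Fin (d + 1)) (RWn : ℕ) :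
    ∑ w ∈ (Fintype.piFinset fun j => Finset.Icc (y j - RWn) (y j + RWn)), ∑ l : Fin (d + 1), ∑ μ : Fin (d + 1),
      ∑ v ∈ (Fintype.piFinset fun j => Finset.Icc (quo N' y j - (4 * (d + 1) + 1 : ℕ)) (quo N' y j + (4 * (d + 1) + 1 : ℕ))).image
        (fun Y : Site (d + 1) => (N' : ℤ) • Y),
        |onLat N' (fun Y => avgLift M (hessFFAt (toSite r) Lc μ Y)) v w y (Sum.inl l) (Sum.inl l')| ≤
      (((2 * RWn + 1) ^ (d + 1) : ℕ) : ℝ) * (((d : ℝ) + 1) * (((d : ℝ) + 1) *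
        ((((2 * (4 * (d + 1) + 1) + 1) ^ (d + 1) : ℕ) : ℝ) * (2 * (ell (d + 1) Lc : ℝ) ^ 2 / (M : ℝ) ^ (2 * (d + 1)))))) := by
  set bnd : ℝ := 2 * (ell (d + 1) Lc : ℝ) ^ 2 / (M : ℝ) ^ (2 * (d + 1)) with hbnd
  set SuY := (Fintype.piFinset fun j => Finset.Icc (quo N' y j - (4 * (d + 1) + 1 : ℕ)) (quo N' y j + (4 * (d + 1) + 1 : ℕ)))
    with hSuY
  have hv : ∀ w (l μ : Fin (d + 1)), ∑ v ∈ SuY.image (fun Y : Site (d + 1) => (N' : ℤ) • Y),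
      |onLat N' (fun Y => avgLift M (hessFFAt (toSite r) Lc μ Y)) v w y (Sum.inl l) (Sum.inl l')| ≤
        ((((2 * (4 * (d + 1) + 1) + 1) ^ (d + 1) : ℕ) : ℝ)) * bnd := by
    intro w l μ
    calc _ ≤ ∑ _v ∈ SuY.image (fun Y : Site (d + 1) => (N' : ℤ) • Y), bnd :=
          Finset.sum_le_sum fun v _ => abs_onLat_avgLift_le hr N' M μ v w y _ _
      _ = ((SuY.image (fun Y : Site (d + 1) => (N' : ℤ) • Y)).card : ℝ) * bnd := by rw [Finset.sum_const, nsmul_eq_mul]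
      _ ≤ _ := by
          refine mul_le_mul_of_nonneg_right ?_ (by positivity)
          have h1 := Finset.card_image_le (s := SuY) (f := fun Y : Site (d + 1) => (N' : ℤ) • Y)
          have h2 : SuY.card = (2 * (4 * (d + 1) + 1) + 1) ^ (d + 1) := card_box _ _
          exact_mod_cast (h1.trans h2.le)
  have hμ : ∀ w (l : Fin (d + 1)), ∑ μ : Fin (d + 1), ∑ v ∈ SuY.image (fun Y : Site (d + 1) => (N' : ℤ) • Y),
      |onLat N' (fun Y => avgLift M (hessFFAt (toSite r) Lc μ Y)) v w y (Sum.inl l) (Sum.inl l')| ≤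
        ((d : ℝ) + 1) * (((((2 * (4 * (d + 1) + 1) + 1) ^ (d + 1) : ℕ) : ℝ)) * bnd) := by
    intro w l
    calc _ ≤ ∑ _μ : Fin (d + 1), ((((2 * (4 * (d + 1) + 1) + 1) ^ (d + 1) : ℕ) : ℝ)) * bnd := Finset.sum_le_sum fun μ _ => hv w l μ
      _ = _ := by simp [mul_comm]
  have hl : ∀ w, ∑ l : Fin (d + 1), ∑ μ : Fin (d + 1), ∑ v ∈ SuY.image (fun Y : Site (d + 1) => (N' : ℤ) • Y),
      |onLat N' (fun Y => avgLift M (hessFFAt (toSite r) Lc μ Y)) v w y (Sum.inl l) (Sum.inl l')| ≤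
        ((d : ℝ) + 1) * (((d : ℝ) + 1) * (((((2 * (4 * (d + 1) + 1) + 1) ^ (d + 1) : ℕ) : ℝ)) * bnd)) := by
    intro w
    calc _ ≤ ∑ _l : Fin (d + 1), ((d : ℝ) + 1) * (((((2 * (4 * (d + 1) + 1) + 1) ^ (d + 1) : ℕ) : ℝ)) * bnd) :=
          Finset.sum_le_sum fun l _ => hμ w l
      _ = _ := by simp [mul_comm]
  calc _ ≤ ∑ _w ∈ (Fintype.piFinset fun j => Finset.Icc (y j - RWn) (y j + RWn)),
        ((d : ℝ) + 1) * (((d : ℝ) + 1) * (((((2 * (4 * (d + 1) + 1) + 1) ^ (d + 1) : ℕ) : ℝ)) * bnd)) :=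
        Finset.sum_le_sum fun w _ => hl w
    _ = _ := by rw [Finset.sum_const, nsmul_eq_mul, card_box]

/-! ## §4a The rewritten sandwich is bounded -/

/-- [folklore] **THE REWRITTEN SANDWICH IS BOUNDED** by the owner's `TaylorSandwich.sandwich_bound`: outer legs in (N1)'s block-`ℓ¹`
currency (`CA`, `CB`), vertex leg `= onLat (N^{d+2}·𝒬ᵀ_R Φ̃_N)` (`R` read-outs of the top multiplier leg: `CH = N^{d+2}·R·CΦ·N^{−2(d+1)}·e^κ`),
table `= onLat (avgLift M ∘ hessFFAt (toSite r) Lc μ)` (leaf-11's sup × the two support boxes: `Mass`), radii `RW/N`, `RU/N` bounded free of the level. -/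
theorem abs_sandwich_le (hr : r ∈ box (d + 1) Lc) (ℓ k p : ℕ) (hp : p = ℓ + k + 1) {κ CA CB CΦ : ℝ} (hκ : 0 < κ) (hCΦ : 0 ≤ CΦ)
    (hA : ∀ (α l : Fin (d + 1)) (x' w : Site (d + 1)),
      |((Lc : ℝ) ^ p) ^ (d + 2) * GamΦ (N := Lc ^ p) α x' l w| ≤
        CA * Real.exp (-κ * l1 (x' - quo (Lc ^ p) w)))
    (hB : ∀ (κ₁ l : Fin (d + 1)) (z : Site (d + 1)),
      |((Lc : ℝ) ^ p) ^ (d + 2) * wH (N := Lc ^ p) κ₁ l z| ≤ CB * Real.exp (-κ * l1 (quo (Lc ^ p) z)))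
    (hΦ : ∀ (κ₁ l : Fin (d + 1)) (y : Site (d + 1)),
      |((Lc : ℝ) ^ p) ^ (2 * (d + 1)) * wΦ (N := Lc ^ p) κ₁ l y| ≤ CΦ * Real.exp (-κ * l1 y))
    (κ' : Fin (d + 1)) (u' x' z' : Site (d + 1)) (α β : Fin (d + 1)) :
    |∑' y : Site (d + 1), ∑ l' : Fin (d + 1),
        (∑' w : Site (d + 1), ∑ l : Fin (d + 1),
            ((((Lc ^ p : ℕ) : ℝ)) ^ (d + 2) * GamΦ (N := Lc ^ p) α x' l w) *
              ∑ μ : Fin (d + 1), ((((Lc ^ p : ℕ) : ℝ)) ^ (d + 1))⁻¹ * ∑' v : Site (d + 1),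
                onLat (Lc ^ (ℓ + 1)) (fun Y => (((Lc ^ p : ℕ) : ℝ)) ^ (d + 2) *
                    contourSumAdj (Lc ^ k) (fun κ₁ q => wΦ (N := Lc ^ p) κ₁ κ' (q - u')) μ Y) v *
                  onLat (Lc ^ (ℓ + 1)) (fun Y => avgLift (Lc ^ ℓ) (hessFFAt (toSite r) Lc μ Y)) v w y (Sum.inl l) (Sum.inl l')) *
          ((((Lc ^ p : ℕ) : ℝ)) ^ (d + 2) * wH (N := Lc ^ p) l' β (y - ((Lc ^ p : ℕ) : ℤ) • z'))| ≤
      ((d : ℝ) + 1) * (CA * CB *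
          ((((Lc ^ p : ℕ) : ℝ)) ^ (d + 2) * ((Lc : ℝ) ^ k * ((CΦ * (((Lc : ℝ) ^ p) ^ (2 * (d + 1)))⁻¹) * Real.exp κ))) *
          ((((2 * (2 * (2 * (d + 1) * (Lc + 1) * Lc ^ ℓ)) + 1) ^ (d + 1) : ℕ) : ℝ) * (((d : ℝ) + 1) * (((d : ℝ) + 1) *
            ((((2 * (4 * (d + 1) + 1) + 1) ^ (d + 1) : ℕ) : ℝ) * (2 * (ell (d + 1) Lc : ℝ) ^ 2 / ((Lc : ℝ) ^ ℓ) ^ (2 * (d + 1))))))) *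
          (Real.exp (κ * (((d : ℝ) + 1) * (4 * ((d : ℝ) + 1) * (Lc + 1)) + (d + 1))) *
            Real.exp (κ * (((d : ℝ) + 1) * ((4 * ((d : ℝ) + 1) + 1) + 1) + (d + 1))))) *
        Zl (d + 1) (κ / 2) * Real.exp (-(κ / 2) * (l1 (x' - u') + l1 (z' - u'))) := by
  subst hp
  have hL0 : (0 : ℝ) < Lc := by exact_mod_cast Nat.pos_of_ne_zero (NeZero.ne Lc)
  have hL1 : (1 : ℝ) ≤ Lc := by exact_mod_cast (Nat.one_le_iff_ne_zero.2 (NeZero.ne Lc))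
  haveI hN0 : NeZero (Lc ^ (ℓ + k + 1)) := ⟨pow_ne_zero _ (NeZero.ne Lc)⟩
  haveI hNp0 : NeZero (Lc ^ (ℓ + 1)) := ⟨pow_ne_zero _ (NeZero.ne Lc)⟩
  haveI hM0 : NeZero (Lc ^ ℓ) := ⟨pow_ne_zero _ (NeZero.ne Lc)⟩
  have hNR : Lc ^ (ℓ + k + 1) = Lc ^ (ℓ + 1) * Lc ^ k := by rw [← pow_add]; ring_nf
  have hNp : Lc ^ (ℓ + 1) = Lc ^ ℓ * Lc := pow_succ Lc ℓ
  have hcast : (((Lc ^ (ℓ + k + 1) : ℕ) : ℝ)) = (Lc : ℝ) ^ (ℓ + k + 1) := by push_cast; rfl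
  have hcastP : (((Lc ^ (ℓ + 1) : ℕ) : ℝ)) = (Lc : ℝ) ^ (ℓ + 1) := by push_cast; rfl
  have hcastM : (((Lc ^ ℓ : ℕ) : ℝ)) = (Lc : ℝ) ^ ℓ := by push_cast; rfl
  have hcastR : (((Lc ^ k : ℕ) : ℝ)) = (Lc : ℝ) ^ k := by push_cast; rfl
  set RWn : ℕ := 2 * (2 * (d + 1) * (Lc + 1) * Lc ^ ℓ) with hRWn
  set RW : ℝ := ((d : ℝ) + 1) * (4 * ((d : ℝ) + 1) * (Lc + 1)) * ((Lc ^ (ℓ + k + 1) : ℕ) : ℝ) with hRW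
  set RU : ℝ := ((d : ℝ) + 1) * ((4 * ((d : ℝ) + 1) + 1) + 1) * ((Lc ^ (ℓ + k + 1) : ℕ) : ℝ) with hRU
  -- the legs in the `ℕ`-cast currency of `sandwich_bound`
  have hA' : ∀ (l : Fin (d + 1)) (w : Site (d + 1)),
      |((Lc ^ (ℓ + k + 1) : ℕ) : ℝ) ^ (d + 2) * GamΦ (N := Lc ^ (ℓ + k + 1)) α x' l w| ≤
        CA * Real.exp (-κ * l1 (x' - quo (Lc ^ (ℓ + k + 1)) w)) := fun l w => by
    rw [hcast]; exact hA α l x' w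
  have hB' : ∀ (l' : Fin (d + 1)) (y : Site (d + 1)),
      |((Lc ^ (ℓ + k + 1) : ℕ) : ℝ) ^ (d + 2) * wH (N := Lc ^ (ℓ + k + 1)) l' β (y - ((Lc ^ (ℓ + k + 1) : ℕ) : ℤ) • z')| ≤
        CB * Real.exp (-κ * l1 (quo (Lc ^ (ℓ + k + 1)) y - z')) := fun l' y => by
    have hq : quo (Lc ^ (ℓ + k + 1)) (y - ((Lc ^ (ℓ + k + 1) : ℕ) : ℤ) • z') = quo (Lc ^ (ℓ + k + 1)) y - z' := by
      rw [sub_eq_add_neg y, ← smul_neg, BlochFibreUniqueness.quo_add_zsmul, ← sub_eq_add_neg]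
    rw [hcast, ← hq]
    exact hB l' β _
  have hΦ' : ∀ κ₁ q, |wΦ (N := Lc ^ (ℓ + k + 1)) κ₁ κ' q| ≤
      CΦ * (((Lc : ℝ) ^ (ℓ + k + 1)) ^ (2 * (d + 1)))⁻¹ * Real.exp (-κ * l1 q) := by
    intro κ₁ q
    have hpow : (0 : ℝ) < ((Lc : ℝ) ^ (ℓ + k + 1)) ^ (2 * (d + 1)) := by positivity
    have h := hΦ κ₁ κ' q
    rw [abs_mul, abs_of_pos hpow] at h
    calc |wΦ (N := Lc ^ (ℓ + k + 1)) κ₁ κ' q|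
        = (((Lc : ℝ) ^ (ℓ + k + 1)) ^ (2 * (d + 1)))⁻¹ *
            ((((Lc : ℝ) ^ (ℓ + k + 1)) ^ (2 * (d + 1))) * |wΦ (N := Lc ^ (ℓ + k + 1)) κ₁ κ' q|) := by
          rw [← mul_assoc, inv_mul_cancel₀ hpow.ne', one_mul]
      _ ≤ (((Lc : ℝ) ^ (ℓ + k + 1)) ^ (2 * (d + 1)))⁻¹ * (CΦ * Real.exp (-κ * l1 q)) :=
          mul_le_mul_of_nonneg_left h (by positivity)
      _ = _ := by ring
  have hH' : ∀ (μ : Fin (d + 1)) (v : Site (d + 1)),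
      |onLat (Lc ^ (ℓ + 1)) (fun Y => ((Lc ^ (ℓ + k + 1) : ℕ) : ℝ) ^ (d + 2) *
          contourSumAdj (Lc ^ k) (fun κ₁ q => wΦ (N := Lc ^ (ℓ + k + 1)) κ₁ κ' (q - u')) μ Y) v| ≤
        (|(((Lc ^ (ℓ + k + 1) : ℕ) : ℝ)) ^ (d + 2)| * ((Lc ^ k : ℕ) * ((CΦ * (((Lc : ℝ) ^ (ℓ + k + 1)) ^ (2 * (d + 1)))⁻¹) * Real.exp κ))) *
          Real.exp (-κ * l1 (quo (Lc ^ (ℓ + k + 1)) v - u')) := fun μ v =>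
    abs_vertexLeg_le (d := d) hNR κ' μ u' v (((Lc ^ (ℓ + k + 1) : ℕ) : ℝ) ^ (d + 2)) hκ.le
      (by positivity) hΦ'
  have hS := sandwich_bound (d := d) (N := Lc ^ (ℓ + k + 1)) (κ := κ) (CA := CA) (CB := CB)
    (CH := |(((Lc ^ (ℓ + k + 1) : ℕ) : ℝ)) ^ (d + 2)| * ((Lc ^ k : ℕ) * ((CΦ * (((Lc : ℝ) ^ (ℓ + k + 1)) ^ (2 * (d + 1)))⁻¹) * Real.exp κ)))
    (Mass := (((2 * RWn + 1) ^ (d + 1) : ℕ) : ℝ) * (((d : ℝ) + 1) * (((d : ℝ) + 1) *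
      ((((2 * (4 * (d + 1) + 1) + 1) ^ (d + 1) : ℕ) : ℝ) * (2 * (ell (d + 1) Lc : ℝ) ^ 2 / (((Lc ^ ℓ : ℕ) : ℝ)) ^ (2 * (d + 1)))))))
    (RW := RW) (RU := RU) (x' := x') (u' := u') (z' := z')
    (A := fun l w => ((Lc ^ (ℓ + k + 1) : ℕ) : ℝ) ^ (d + 2) * GamΦ (N := Lc ^ (ℓ + k + 1)) α x' l w)
    (B := fun l' y => ((Lc ^ (ℓ + k + 1) : ℕ) : ℝ) ^ (d + 2) * wH (N := Lc ^ (ℓ + k + 1)) l' β (y - ((Lc ^ (ℓ + k + 1) : ℕ) : ℤ) • z'))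
    (H := fun μ v => onLat (Lc ^ (ℓ + 1)) (fun Y => ((Lc ^ (ℓ + k + 1) : ℕ) : ℝ) ^ (d + 2) *
      contourSumAdj (Lc ^ k) (fun κ₁ q => wΦ (N := Lc ^ (ℓ + k + 1)) κ₁ κ' (q - u')) μ Y) v)
    (T := fun μ v w l y l' => onLat (Lc ^ (ℓ + 1)) (fun Y => avgLift (Lc ^ ℓ) (hessFFAt (toSite r) Lc μ Y)) v w y (Sum.inl l) (Sum.inl l'))
    (Sw := fun y => Fintype.piFinset fun j => Finset.Icc (y j - RWn) (y j + RWn))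
    (Su := fun y => (Fintype.piFinset fun j =>
        Finset.Icc (quo (Lc ^ (ℓ + 1)) y j - (4 * (d + 1) + 1 : ℕ)) (quo (Lc ^ (ℓ + 1)) y j + (4 * (d + 1) + 1 : ℕ))).image
      (fun Y : Site (d + 1) => ((Lc ^ (ℓ + 1) : ℕ) : ℤ) • Y))
    hκ hA' hB' hH'
    (fun μ v w l y l' hne => mem_boxW_of_ne_zero (Lc := Lc) hr (Lc ^ (ℓ + 1)) (Lc ^ ℓ) hne)
    (fun μ v w l y l' hne => mem_imageY_of_ne_zero (Lc := Lc) hr (Lc ^ (ℓ + 1)) (Lc ^ ℓ) hNp hne)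
    (fun y w hw => by
      have h := l1_le_of_mem_box hw
      have hle : ((d : ℝ) + 1) * RWn ≤ RW := by
        rw [hRW, hRWn, hcast]
        push_cast
        have hmono : ((Lc : ℝ) ^ ℓ) ≤ (Lc : ℝ) ^ (ℓ + k + 1) := pow_le_pow_right₀ hL1 (by omega)
        nlinarith [hmono, show (0 : ℝ) ≤ ((d : ℝ) + 1) * (4 * ((d : ℝ) + 1) * (Lc + 1)) by positivity]
      exact h.trans hle)
    (fun y v hv => by
      have h := l1_le_of_mem_imageY (d := d) (Lc ^ (ℓ + 1)) hv
      have hle : ((d : ℝ) + 1) * ((Lc ^ (ℓ + 1) : ℕ) : ℝ) * ((4 * (d + 1) + 1 : ℕ) + 1) ≤ RU := by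
        rw [hRU, hcastP, hcast]
        push_cast
        have hmono : ((Lc : ℝ) ^ (ℓ + 1)) ≤ (Lc : ℝ) ^ (ℓ + k + 1) := pow_le_pow_right₀ hL1 (by omega)
        nlinarith [hmono, show (0 : ℝ) ≤ ((d : ℝ) + 1) * ((4 * ((d : ℝ) + 1) + 1) + 1) by positivity]
      exact h.trans hle)
    (fun y l' => table_mass_le (Lc := Lc) hr (Lc ^ (ℓ + 1)) (Lc ^ ℓ) y l' RWn)
  -- cancel `RW/N`, `RU/N` and display the constants through `(Lc:ℝ)` powers
  have hNpos : (0 : ℝ) < ((Lc ^ (ℓ + k + 1) : ℕ) : ℝ) := by rw [hcast]; positivity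
  have hRW' : RW / ((Lc ^ (ℓ + k + 1) : ℕ) : ℝ) = ((d : ℝ) + 1) * (4 * ((d : ℝ) + 1) * (Lc + 1)) := by
    rw [hRW]; field_simp
  have hRU' : RU / ((Lc ^ (ℓ + k + 1) : ℕ) : ℝ) = ((d : ℝ) + 1) * ((4 * ((d : ℝ) + 1) + 1) + 1) := by
    rw [hRU]; field_simp
  have hCHabs : |(((Lc ^ (ℓ + k + 1) : ℕ) : ℝ)) ^ (d + 2)| = (((Lc ^ (ℓ + k + 1) : ℕ) : ℝ)) ^ (d + 2) :=
    abs_of_pos (pow_pos hNpos _)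
  rw [hRW', hRU', hCHabs, hcastR, hcastM] at hS
  exact hS

end Table

end Summit.QuantumFields.BalabanUV.Beta.GAN24.TaylorRowLamAt
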